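import Literature.NumberTheory.Automorphic.TorusCharacterLocalComponents     -- ★ `locTorusIncl`, `torusLocalComponent`, `semilocalUnits_*`, `locTorusIncl_mem_localUnitIdeles_of_smul_eq`
import HarnessLib

/-!
# R90 · S10 — THE LEVEL READ-OUT IN TORUS CURRENCY: «`ψ` spherical at `w`» (trivial on the torus idèles integral above `w`) ⇒ `ψ_w = 1` on the INTEGRAL
# points of the local torus `T(F_w)` — at EVERY finite place `w`, split or not (DEAL #65; PROOF, 0 sorry)

Cell `hodgecm-mathlib`, crux H413 (`stmt-HodgeConjecture-24833`), route of record `HCCMUnconditional`; slab R90-TF, section S10 = §13.8; seat R90-C138-p06 (g0),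
DEAL #65 (dealer R90-C138-plan (g3)).  Proof lane (`--kind proof --supports stmt-HodgeConjecture-24833 --as helper`); THEOREMS ONLY; Literature-only import.
CONSUMER: p08 (g2)'s `H1`-side bridge (`θloc w := (torusLocalComponent L c w ψ).comp (localDet c w _)`; the off-`v` conjunct of my ★ `exists_flathBlockH`'s binder
`hχθK` from the L-C′ letter ★ `TorusCharExtendLetter`'s idelic «spherical off `v`» clause).

THE MATHEMATICS (folklore; [PlatonovRapinchuk1994 §6.2], [Arthur2011Draft d-p. 310]).  ★ `locTorusIncl E c v : T(F_v) →* T(𝔸_F)` sends a local norm-one unit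
`t ∈ (∏_{W∣v} E_W)ˣ` to the idèle with components `t_W` above `v` and `1` elsewhere (★ `semilocalUnits`).  That idèle lies in the level group ★
`IdeleHerbrand.localUnitIdeles F E v` («supported above `v`, a unit everywhere») iff `t` is INTEGRAL: `|t_W|_W = 1` for every `W ∣ v` (§1,
`locTorusIncl_mem_localUnitIdeles_of_valued_eq_one`; at a NON-SPLIT `v` this is automatic — the local torus is compact, ★ `locTorusIncl_mem_localUnitIdeles_of_smul_eq`).
Hence a character `ψ` of `T(𝔸_F)` that is TRIVIAL on the torus idèles in `localUnitIdeles F E v` (the idelic «spherical at `v`» token of ★ TorusDictionary §45.13 and of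
★ `R90.S10.TorusCharExtendLetter`) has local component `ψ_v = torusLocalComponent E c v ψ` EQUAL TO `1` on every integral `t` (§2, the dealt name
`torusLocalComponent_eq_one_of_trivial_on_localUnitIdeles`), and on ALL of `T(F_v)` at a non-split `v` (★ `torusLocalComponent_eq_one_of_spherical`, recalled).  The
`U(Φ₁)(L⁺_w)`-reading (`k ∈ cmLocalIntegralLevel L 1 Φ₁ w ⇒ localDet k` integral ⇒ `θloc w k = 1`) is p08's bridge over ★ `mem_cmLocalIntegralLevel_iff_mat`; not here.
HONEST LABEL: a brick; pays no socket; HC_CM is proved only modulo the 7 printed citations (2 remaining named inputs: hLiu418 = stmt-HodgeConjecture-24832, h413 =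
stmt-HodgeConjecture-24833) until rung 0 closes; REL ≠ ★ ≠ BUILT.

## References
* [PlatonovRapinchuk1994] V. Platonov, A. Rapinchuk, *Algebraic Groups and Number Theory* (1994), §6.2.
* [Arthur2011Draft] J. Arthur, *The Endoscopic Classification of Representations* (2011 draft), d-p. 310.
* [TateThesis1967] J. Tate, *Fourier analysis in number fields and Hecke's zeta-functions*, in Cassels–Fröhlich (1967), §3.2.
-/

set_option autoImplicit false
-- the mandated namespace repeats the single-problem summit's segment (`HodgeConjecture.HodgeConjecture`)
set_option linter.dupNamespace false

noncomputable section

open NumberField IsDedekindDomain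
open Literature.NumberTheory.GaloisRepresentations
open Literature.NumberTheory.Automorphic Literature.NumberTheory.Automorphic.UnitaryGroup
open Literature.NumberTheory.Automorphic.Arthur2013.Leaves.TECR

namespace Summit.HodgeConjecture.HodgeConjecture.R90.S10

variable {F : Type} (E : Type) [Field F] [NumberField F] [Field E] [NumberField E] [Algebra F E]
  (c : E ≃ₐ[F] E) {v : HeightOneSpectrum (𝓞 F)}

/-! ## §1 Integral local torus elements are level idèles — at EVERY finite place -/

/-- **An INTEGRAL local norm-one unit maps into the level group**: if `|t_W|_W = 1` for every place `W ∣ v` of `E`, then `locTorusIncl v t ∈ T(𝒪_v) := T(𝔸_F) ∩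
∏_{W∣v} 𝒪_W^×` (★ `IdeleHerbrand.localUnitIdeles F E v`: infinite part `1`, components off `v` equal to `1`, units everywhere) — at every finite `v`, split or not.
[cite: PlatonovRapinchuk1994, §6.2] [cite: TateThesis1967, §3.2] -/
theorem locTorusIncl_mem_localUnitIdeles_of_valued_eq_one (t : ↥(normOneUnits (conjLocal E c v)))
    (ht : ∀ W : PlacesOver E v, Valued.v ((((t : (LocalRing E v)ˣ) : LocalRing E v)) W) = 1) :
    ((locTorusIncl E c v t : TorusDict.torus c) : ideleGroup E) ∈ IdeleHerbrand.localUnitIdeles F E v := by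
  refine IdeleHerbrand.mem_localUnitIdeles_iff.2 ⟨?_, fun q hq => ?_, fun q => ?_⟩
  · rw [coe_locTorusIncl]; exact semilocalUnits_fst E _
  · rw [coe_locTorusIncl]; exact semilocalUnits_snd_apply_of_not_over E _ hq
  · by_cases hq : q.under (𝓞 F) = v
    · rw [coe_locTorusIncl, semilocalUnits_snd_apply_of_over E _ ⟨q, hq⟩]
      exact ht ⟨q, hq⟩
    · rw [coe_locTorusIncl, semilocalUnits_snd_apply_of_not_over E _ hq, map_one]

/-! ## §2 The read-out: spherical at `v` ⇒ `ψ_v = 1` on the integral points -/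

/-- **DEAL #65 `torusLocalComponent_eq_one_of_trivial_on_localUnitIdeles`** — if `ψ : T(𝔸_F) → ℂˣ` is trivial on the torus idèles in the level group above `v` (the
idelic «spherical at `v`»: `∀ t ∈ T(𝔸_F), t ∈ localUnitIdeles F E v → ψ t = 1`), then its local component `ψ_v` (★ `torusLocalComponent`) is `1` on every INTEGRAL element
of the local torus `T(F_v)` (`|t_W|_W = 1` for all `W ∣ v`) — at EVERY finite `v`.  At a non-split `v` the integrality is automatic (★ `torusLocalComponent_eq_one_of_spherical`).
[cite: PlatonovRapinchuk1994, §6.2] [cite: Arthur2011Draft, d-p. 310] -/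
theorem torusLocalComponent_eq_one_of_trivial_on_localUnitIdeles (ψ : ↥(TorusDict.torus c) →ₜ* ℂˣ) (v : HeightOneSpectrum (𝓞 F))
    (hψv : ∀ t : ↥(TorusDict.torus c), (t : ideleGroup E) ∈ IdeleHerbrand.localUnitIdeles F E v → ψ t = 1)
    (t : ↥(normOneUnits (conjLocal E c v))) (ht : ∀ W : PlacesOver E v, Valued.v ((((t : (LocalRing E v)ˣ) : LocalRing E v)) W) = 1) :
    torusLocalComponent E c v ψ t = 1 := by
  rw [torusLocalComponent_apply]
  exact hψv _ (locTorusIncl_mem_localUnitIdeles_of_valued_eq_one E c t ht)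

/-- **The whole local component vanishes off the integral obstruction at a NON-SPLIT place** (recalled form of ★ `torusLocalComponent_eq_one_of_spherical`, stated next to
§2 for the consumer): `ψ` spherical at a non-split `v` ⇒ `ψ_v = 1` identically. [cite: Arthur2011Draft, d-p. 310] -/
theorem torusLocalComponent_eq_one_of_trivial_on_localUnitIdeles_of_smul_eq (ψ : ↥(TorusDict.torus c) →ₜ* ℂˣ) (v : HeightOneSpectrum (𝓞 F))
    (hv : ∀ W : PlacesOver E v, c • W.1 = W.1)
    (hψv : ∀ t : ↥(TorusDict.torus c), (t : ideleGroup E) ∈ IdeleHerbrand.localUnitIdeles F E v → ψ t = 1)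
    (t : ↥(normOneUnits (conjLocal E c v))) : torusLocalComponent E c v ψ t = 1 :=
  torusLocalComponent_eq_one_of_spherical E c hv ψ hψv t

end Summit.HodgeConjecture.HodgeConjecture.R90.S10

end
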